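import Summits.BirchSwinnertonDyer.BirchSwinnertonDyer.Theorems.ManinLocalTwoThreeBlindResidualEdges
import Summits.BirchSwinnertonDyer.BirchSwinnertonDyer.Theorems.ManinLocalTwoThreeShimuraQuotientRational
import HarnessLib

/-!
# C2 `ManinOddAtFour` BY NAME with the blind residual routed through STEVENS' PARITY: C2 ⟸ F♯ ∧ E-an-48 ∧ E-an-53 ∧ F★ ∧ hex ∧ C2¹
# (route `ManinLocalTwoThree`, cell bsd-f2-manin; crux C2 `ManinOddAtFour` stmt-BirchSwinnertonDyer-22967; LEAD seat p1 gen 11)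

THE POINT.  The skeleton of record `kato_shift_two` v13 closes the TOTALLY BLIND residual of C2 (`ShimuraLedger.RbTotallyBlind`: optimal
`W` with `4 ∣ N` all of whose rational 2-torsion is Kummer-blind) by two cell laws — an's tame parity law E-an-73
`BlindTameOptimalOddDegree` (+ the printed ČNS Thm 1.2) and the wild orbit-minimal residual WILD-OM.  Gen 10 of this seat proved the
Γ₀/Γ₁ TRANSFER on that locus modulo ONE printed rationality fact F★ (`totallyBlindGammaOneTransfer_of_cusp_rational`,
`…ShimuraQuotientRational.lean`, p674190: `|c₀| = |c₁|` on totally blind classes), and an g16 had typed the transfer edge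
`OddDegreeTooth.rbTotallyBlind_of_transfer_of_exists : TotallyBlindGammaOneTransfer → exists_optimal_gamma1ParametrizationData →
GammaOneOddOnBlindClasses → RbTotallyBlind`.  Composing: the blind residual follows from F★, the printed existence of Stevens'
`X₁(N)`-optimal datum (`hex`, Literature named fact) and ONE law, **C2¹ = `ShimuraLedger.GammaOneOddOnBlindClasses`** (the Manin–STEVENS
constant `c₁` of the `X₁(N)`-optimal curve of a totally blind class is odd — an instance of Stevens' Conjecture I′ `c₁ = ±1`, Stevens
1989, open beyond `ord₂(N) ≤ 1`, Česnavičius 2016).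

RESULTS (sorry-free, pure compositions):
* `rbTotallyBlind_of_cusp_rational_of_gammaOneOdd : F★ → hex → C2¹ → RbTotallyBlind`;
* **`maninOddAtFour_of_katoFact_of_cuspidalKummer_of_cusp_rational_of_gammaOneOdd`**: C2 `ManinOddAtFour` ⟸ F♯ (Kato, real-subfield
  form, Literature statement-only) ∧ E-an-48 `CuspidalKummerRepresentativeAtFour` ∧ E-an-53 `CuspidalKummerOddExponent` ∧ F★
  `optimalGamma1Parametrization_cusp_rational` ∧ `exists_optimal_gamma1ParametrizationData` ∧ C2¹ `GammaOneOddOnBlindClasses` — the v10/v13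
  composition `maninOddAtFour_of_katoFact_of_cuspidalKummer_of_blindOrbitMinimal` with its blind input so fed.
Compared with v13's hypothesis set {F♯, E-an-48, E-an-53, ČNS 1.2, E-an-73, WILD-OM}: THREE printed/Literature facts {F♯, F★, hex} and THREE
cell laws {E-an-48, E-an-53, C2¹}; C2¹ on the blind locus is implied by {ČNS, E-an-73, WILD-OM} modulo F★ (v13's blind closure + gen 10's
`not_two_dvd_maninConstant₀_iff_of_allBlind_of_cusp_rational`), so this hypothesis set is WEAKER or equal.  LEAD candidate v14 of the
skeleton (HOME/p1/Line-kato-shift-two-v14.lean).  HONEST FRAMING: a CONDITIONAL reduction; every hypothesis is an OPEN law or an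
unformalised printed theorem; C2, Manin's conjecture, Stevens' conjecture and BSD are NOT proved.  No definitions, no sorry.
[cite: Stevens1989, Conj. I′ (a) (shape: C2¹ is its 2-part on blind classes; OPEN)] [cite: ConradEdixhovenStein2003, §6.1.2 and §6.2 (F★)]
-/

set_option autoImplicit false
set_option linter.dupNamespace false

noncomputable section

open scoped Classical MatrixGroups ModularForm
open CongruenceSubgroup
open WeierstrassCurve Literature.NumberTheory.EllipticCurves Literature.NumberTheory.EllipticCurves.ModularForms
open Summit.BirchSwinnertonDyer.Rank1Residual.ManinAdditive
open Summit.BirchSwinnertonDyer.Rank1Residual.ManinAdditive.CuspidalKummer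
open Summit.BirchSwinnertonDyer.Rank1Residual.ManinAdditive.ShimuraLedger
open Summit.BirchSwinnertonDyer.Rank1Residual.ManinAdditive.OddDegreeTooth

namespace Summit.BirchSwinnertonDyer.BirchSwinnertonDyer.Theorems.ManinLocalTwoThree

/-- **The totally blind residual of C2 from F★, the existence of Stevens' optimal `X₁(N)`-datum and C2¹** (transfer `|c₀| = |c₁|`
proved mod F★ in gen 10; an's transfer edge). [cite: ConradEdixhovenStein2003, §6.1.2 and §6.2] -/
theorem rbTotallyBlind_of_cusp_rational_of_gammaOneOdd (hF : optimalGamma1Parametrization_cusp_rational)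
    (hex : exists_optimal_gamma1ParametrizationData) (h₁ : GammaOneOddOnBlindClasses) : RbTotallyBlind :=
  rbTotallyBlind_of_transfer_of_exists (totallyBlindGammaOneTransfer_of_cusp_rational hF) hex h₁

/-- **C2 BY NAME with the blind residual through Stevens' parity**: `ManinOddAtFour` ⟸ F♯ ∧ E-an-48 ∧ E-an-53 ∧ F★ ∧
`exists_optimal_gamma1ParametrizationData` ∧ C2¹ (`GammaOneOddOnBlindClasses`).  CONDITIONAL reduction (LEAD candidate v14 of
`kato_shift_two`); nothing about BSD, Manin's or Stevens' conjecture is proved. [cite: Kato2004Asterisque, Thm. 9.7 (p. 189) (shape of F♯)]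
[cite: Stevens1989, Conj. I′ (a) (shape of C2¹; OPEN)] -/
theorem maninOddAtFour_of_katoFact_of_cuspidalKummer_of_cusp_rational_of_gammaOneOdd
    (hF : kato_neron_isIntegral_twistedSymbolSum_of_additive_two_real)
    (h48 : CuspidalKummerRepresentativeAtFour) (h53 : CuspidalKummerOddExponent)
    (hFstar : optimalGamma1Parametrization_cusp_rational) (hex : exists_optimal_gamma1ParametrizationData)
    (h₁ : GammaOneOddOnBlindClasses) :
    Summit.BirchSwinnertonDyer.BirchSwinnertonDyer.Theses.ManinLocalTwoThree.ManinOddAtFour :=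
  maninOddAtFour_of_katoFact_of_cuspidalKummer_of_blindOrbitMinimal hF h48 h53 ManinOddOfOddEtaExponent_holds
    (blindOrbitMinimalResidual_of_kummerBlindResidualOdd
      (kummerBlindResidualOdd_of_rbTotallyBlind (rbTotallyBlind_of_cusp_rational_of_gammaOneOdd hFstar hex h₁)))

end Summit.BirchSwinnertonDyer.BirchSwinnertonDyer.Theorems.ManinLocalTwoThree

end
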